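import Literature.Barriers.CriticalPhenomena.PositionSpaceRGNonGibbsianContoursEnergy
import Mathlib.Analysis.SpecialFunctions.Log.Basic
import HarnessLib

/-!
# Barrier `PositionSpaceRGNonGibbsian`, Theorem 4.3 (decimation, spacing `b ≥ 3`): the plus phase of
# the internal-spin system, and `VEFS1993_eq413_spacing` — proved

Companion file of `…PositionSpaceRGNonGibbsianContours{,Energy}.lean` (van Enter–Fernández–Sokal 1993,
§4.3.2, App. B.5.3). The per-contour energy gain `H(σ) - H(σ') ≥ |S| / (6 (2r+1)^d)` of the twisted
Peierls transformation (`CtData.card_div_le_gain`) is turned into the Peierls estimate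
`μ(σ_x = -1) ≤ ε(β) → 0` (uniformly in the volume and the parity), by the injectivity of the
transformation on the sub-events "`S` is an external contour with `-` interiors `L`, `-` sites `T` on
`S`, origin spin `s₀`" (`cfgProb_evt_le`), the union bound over these data, the count of
`★`-connected supports (`card_filter_starConn_le`, Friedli–Velenik Lemma 7.30) and a geometric series.
Unfixing the origin (§4.1.2 Step 3) then gives the uniform positive magnetisation at the origin,
i.e. the plus-phase bound of `VEFS1993_plusPhase` for every spacing `b ≥ 3` (`plusPhase_three_le`;
the source: "It follows from P–S theory that at low temperature there are precisely two periodic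
Gibbs measures, `μ₊` and `μ₋`, characterized respectively by a strictly positive or strictly negative
magnetization", §4.3.2), and with the tree's reduction `VEFS1993_eq413_spacing_of_plusPhase_three_le`
the named fact **`VEFS1993_eq413_spacing`** is discharged (`VEFS1993_eq413_spacing_holds`).

Everything is proved; no named facts (D-0014, D-0026).

## References

* A. C. D. van Enter, R. Fernández, A. D. Sokal, J. Stat. Phys. 72 (1993) 879–1167,
  arXiv:hep-lat/9210032 — Theorem 4.3, §4.3.1 Step 2, §4.3.2, §4.1.2 Step 3, App. B.5.3
  [VanenterFernandezSokal1993].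
* S. Friedli, Y. Velenik, *Statistical Mechanics of Lattice Systems*, CUP 2017, §3.7.2 (Peierls
  argument, eqs. (3.36)–(3.40)), Lemma 7.30 (counting contours) [FriedliVelenik2017].
-/

noncomputable section

namespace Literature.Barriers.CriticalPhenomena.NonGibbs

open MeasureTheory Finset Relation Literature.Probability.LatticeModels

namespace SpacingPeierls

variable {d : ℕ}

/-! ### The sub-events of the Peierls estimate and the transformation on finite configurations -/

section Event

variable (b r : ℕ) (p : ℤˣ) (R' : ℕ)

/-- The glued configuration of a finite configuration of `W(R')`. [cite: FriedliVelenik2017, §3.1 (Ω^η_Λ)] -/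
abbrev glueW (τ : spacingVolume d b R' → ℤˣ) : SpinConfig (Site d) :=
  glue (spacingVolume d b R') τ (.fixed (ξb d b p R'))

/-- **The sub-event** "`S` is an external contour of `σ` with `-` interior components exactly `L`, the
`-` spin sites of `S` are exactly `T`, and the origin spin is `s₀`".
[cite: FriedliVelenik2017, §3.7.2 (the event γ ∈ Γ(ω)) and §7.2.6 (labels)] -/
def EvtP (σ : SpinConfig (Site d)) (S : Finset (Site d)) (L : Finset (Finset (Site d))) (T : Finset (Site d)) (s₀ : ℤˣ) : Prop :=
  IsContour b r σ S ∧ IsPlusExt b r σ S ∧ (∀ A ∈ Comps S, A ∈ L ↔ IsMinusComp b r σ A) ∧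
    (∀ y ∈ S, IsSpin b y → (y ∈ T ↔ σ y = -1)) ∧ σ 0 = s₀

/-- The sub-event as a finite set of finite configurations. [cite: FriedliVelenik2017, §3.7.2] -/
def evt (S : Finset (Site d)) (L : Finset (Finset (Site d))) (T : Finset (Site d)) (s₀ : ℤˣ) :
    Finset (spacingVolume d b R' → ℤˣ) :=
  open Classical in univ.filter fun τ => EvtP b r (glueW b p R' τ) S L T s₀

/-- **The transformation on finite configurations**: restrict the transformed glued configuration.
[cite: FriedliVelenik2017, Lemma 3.36] -/
def pmap (S : Finset (Site d)) (L : Finset (Finset (Site d))) (τ : spacingVolume d b R' → ℤˣ) :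
    spacingVolume d b R' → ℤˣ :=
  fun w => tcfg b (glueW b p R' τ) S L w

variable {b r p R'}

/-- Membership in `evt`. [folklore] -/
theorem mem_evt {S : Finset (Site d)} {L : Finset (Finset (Site d))} {T : Finset (Site d)} {s₀ : ℤˣ}
    {τ : spacingVolume d b R' → ℤˣ} : τ ∈ evt b r p R' S L T s₀ ↔ EvtP b r (glueW b p R' τ) S L T s₀ := by
  classical
  simp [evt]

/-- The data of the Peierls estimate on the sub-event. [cite: FriedliVelenik2017, §7.2.6] -/
theorem ctData_of_evtP (hd : 2 ≤ d) (hb : 3 ≤ b) (hr : b + 1 ≤ r) (hrd : 72 * d ≤ r) {σ : SpinConfig (Site d)}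
    (hσ : IsCfg b p R' σ) {S : Finset (Site d)} (hSne : S.Nonempty) (hS : StarConn (S : Set (Site d)))
    {L : Finset (Finset (Site d))} (hL : L ⊆ Comps S) {T : Finset (Site d)} {s₀ : ℤˣ} (hE : EvtP b r σ S L T s₀) :
    CtData d b p R' r σ S L :=
  ⟨hd, hb, hr, hrd, hσ, hSne, hS, hE.1, hE.2.1, hL, hE.2.2.1⟩

/-- The glued transformed configuration is the transformed glued configuration. [cite: FriedliVelenik2017, Lemma 3.36] -/
theorem glueW_pmap {σS : Finset (Site d)} {L : Finset (Finset (Site d))} {τ : spacingVolume d b R' → ℤˣ}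
    (h : CtData d b p R' r (glueW b p R' τ) σS L) : glueW b p R' (pmap b p R' σS L τ) = tcfg b (glueW b p R' τ) σS L := by
  funext u
  by_cases hu : u ∈ spacingVolume d b R'
  · rw [glueW, glue_apply_of_mem _ _ _ hu]; rfl
  · rw [glueW, glue_apply_of_notMem _ _ _ hu, BoundaryCondition.outside_fixed, h.isCfg_σ' u hu]

/-- **The weight inequality**: on the sub-event, `w(τ) ≤ e^{-β |S| / (6(2r+1)^d)} · w(Φ τ)` (`β ≥ 0`).
[cite: FriedliVelenik2017, Lemma 3.36, eq. (3.37)] -/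
theorem isingWeight_le_of_ctData {β : ℝ} (hβ : 0 ≤ β) {S : Finset (Site d)} {L : Finset (Finset (Site d))}
    {τ : spacingVolume d b R' → ℤˣ} (h : CtData d b p R' r (glueW b p R' τ) S L) :
    isingWeight (zdGraph d) (spacingVolume d b R') β 0 (.fixed (ξb d b p R')) τ ≤
      Real.exp (-(β * (#S / (6 * (2 * r + 1) ^ d)))) *
        isingWeight (zdGraph d) (spacingVolume d b R') β 0 (.fixed (ξb d b p R')) (pmap b p R' S L τ) := by
  rw [isingWeight, isingWeight, ← Real.exp_add]
  refine Real.exp_le_exp.2 ?_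
  have hg := h.card_div_le_gain
  have hglue := glueW_pmap h
  rw [glueW] at hglue
  rw [hglue]
  rw [glueW] at hg
  nlinarith

/-- **Injectivity of the transformation on the sub-event.** [cite: FriedliVelenik2017, Lemma 3.36 (the flip is injective)] -/
theorem pmap_injOn (hd : 2 ≤ d) (hb : 3 ≤ b) (hr : b + 1 ≤ r) (hrd : 72 * d ≤ r) {S : Finset (Site d)} (hSne : S.Nonempty)
    (hS : StarConn (S : Set (Site d))) {L : Finset (Finset (Site d))} (hL : L ⊆ Comps S) (T : Finset (Site d)) (s₀ : ℤˣ) :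
    Set.InjOn (pmap b p R' S L) (evt b r p R' S L T s₀) := by
  intro τ₁ h₁ τ₂ h₂ hh
  have hE₁ := mem_evt.1 (mem_coe.1 h₁)
  have hE₂ := mem_evt.1 (mem_coe.1 h₂)
  have c₁ : CtData d b p R' r (glueW b p R' τ₁) S L := ctData_of_evtP hd hb hr hrd (isCfg_glue τ₁) hSne hS hL hE₁
  have c₂ : CtData d b p R' r (glueW b p R' τ₂) S L := ctData_of_evtP hd hb hr hrd (isCfg_glue τ₂) hSne hS hL hE₂
  -- the transformed configurations agree on `W`
  have hval : ∀ w ∈ spacingVolume d b R', tcfg b (glueW b p R' τ₁) S L w = tcfg b (glueW b p R' τ₂) S L w := fun w hw => by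
    have := congrFun hh ⟨w, hw⟩; exact this
  funext ⟨w, hw⟩
  have hws : IsSpin b w := isSpin_of_mem_spacingVolume hw
  have e₁ : τ₁ ⟨w, hw⟩ = glueW b p R' τ₁ w := by rw [glueW, glue_apply_of_mem _ _ _ hw]
  have e₂ : τ₂ ⟨w, hw⟩ = glueW b p R' τ₂ w := by rw [glueW, glue_apply_of_mem _ _ _ hw]
  rw [e₁, e₂]
  by_cases hwS : w ∈ S
  · -- on `S`: read off from `T`
    have t₁ := hE₁.2.2.2.1 w hwS hws
    have t₂ := hE₂.2.2.2.1 w hwS hws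
    rcases Int.units_eq_one_or (glueW b p R' τ₁ w) with h1 | h1 <;> rcases Int.units_eq_one_or (glueW b p R' τ₂ w) with h2 | h2
    · rw [h1, h2]
    · exact absurd (t₁.1 (t₂.2 h2)) (by rw [h1]; decide)
    · exact absurd (t₂.1 (t₁.2 h1)) (by rw [h2]; decide)
    · rw [h1, h2]
  by_cases hwN : w ∈ minusSet L
  · by_cases hw0 : w = 0
    · subst hw0; rw [hE₁.2.2.2.2, hE₂.2.2.2.2]
    have hwi : ¬ IsSpImageSite d b w := not_isSpImageSite_of_isSpin hws hw0
    by_cases hwv : w + shiftVec d b ∈ minusSet L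
    · -- bulk: read off from the transformed spin at `w + v`
      have hwvs : IsSpin b (w + shiftVec d b) := isSpin_of_not_isSpImageSite (by
        rw [c₁.shiftVec_eq', isSpImageSite_add_bvec_iff]; exact hwi)
      have hwvS : w + shiftVec d b ∉ S := (c₁.not_mem_S_of_mem_N hwv).1
      have hwvW : w + shiftVec d b ∈ spacingVolume d b R' := c₁.mem_W_of_mem_N hwv hwvs
      have k₁ : tcfg b (glueW b p R' τ₁) S L (w + shiftVec d b) = -glueW b p R' τ₁ w := by
        rw [tcfg, newCfg_of_mem_N_of_mem _ hwvs hwvS hwv (by rwa [add_sub_cancel_right]), add_sub_cancel_right]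
      have k₂ : tcfg b (glueW b p R' τ₂) S L (w + shiftVec d b) = -glueW b p R' τ₂ w := by
        rw [tcfg, newCfg_of_mem_N_of_mem _ hwvs hwvS hwv (by rwa [add_sub_cancel_right]), add_sub_cancel_right]
      have := hval _ hwvW
      rw [k₁, k₂] at this
      exact neg_injective this
    · -- right rim: both are `-1`
      rw [c₁.apply_eq_neg_one_of_mem_N hwN hws hwv ((supDist_add_shiftVec_le b w).trans c₁.hbr),
        c₂.apply_eq_neg_one_of_mem_N hwN hws hwv ((supDist_add_shiftVec_le b w).trans c₂.hbr)]
  · -- off `S ∪ N`: unchanged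
    have := hval w hw
    rwa [CtData.σ'_of_not_mem hwS hwN, CtData.σ'_of_not_mem hwS hwN] at this

/-- **The probability of a sub-event**: `cfgProb (evt S L T s₀) ≤ e^{-β |S| / (6 (2r+1)^d)}`.
[cite: FriedliVelenik2017, Lemma 3.36] -/
theorem cfgProb_evt_le (hd : 2 ≤ d) (hb : 3 ≤ b) (hr : b + 1 ≤ r) (hrd : 72 * d ≤ r) {β : ℝ} (hβ : 0 ≤ β)
    {S : Finset (Site d)} (hSne : S.Nonempty) (hS : StarConn (S : Set (Site d))) {L : Finset (Finset (Site d))}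
    (hL : L ⊆ Comps S) (T : Finset (Site d)) (s₀ : ℤˣ) :
    cfgProb (zdGraph d) (spacingVolume d b R') β 0 (.fixed (ξb d b p R')) (evt b r p R' S L T s₀) ≤
      Real.exp (-(β * (#S / (6 * (2 * r + 1) ^ d)))) :=
  cfgProb_le_of_injOn (zdGraph d) _ β 0 _ (pmap_injOn hd hb hr hrd hSne hS hL T s₀) (Real.exp_pos _).le fun τ hτ =>
    isingWeight_le_of_ctData hβ (ctData_of_evtP hd hb hr hrd (isCfg_glue τ) hSne hS hL (mem_evt.1 hτ))

end Event

/-! ### The union bound over contours -/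

section Union

variable {b r : ℕ} {p : ℤˣ} {R' : ℕ}

variable (b r R') in
/-- The `★`-connected candidate supports of size `n` anchored at `x`. [cite: FriedliVelenik2017, Lemma 7.30] -/
def supports (x : Site d) (n : ℕ) : Finset (Finset (Site d)) :=
  open Classical in (supBall (n - 1) x).powerset.filter fun S => #S = n ∧ StarConn (S : Set (Site d))

/-- Membership in `supports`. [folklore] -/
theorem mem_supports {x : Site d} {n : ℕ} {S : Finset (Site d)} :
    S ∈ supports x n ↔ S ⊆ supBall (n - 1) x ∧ #S = n ∧ StarConn (S : Set (Site d)) := by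
  classical
  rw [supports, mem_filter, mem_powerset]

/-- **Counting anchored supports**: `#supports x n ≤ (2n-1)^d (3^d)^{2(n-1)}` — every support contains a
point of the anchor ball, and the supports through a given point are counted by `ContourSetup.card_filter_starConn_le`.
[cite: FriedliVelenik2017, Lemma 7.30] -/
theorem card_supports_le (x : Site d) {n : ℕ} (hn : 1 ≤ n) :
    #(supports x n) ≤ (2 * (n - 1) + 1) ^ d * (3 ^ d) ^ (2 * (n - 1)) := by
  classical
  have hcover : supports x n ⊆ (supBall (n - 1) x).biUnion fun v => (supports x n).filter fun S => v ∈ S := by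
    intro S hS
    obtain ⟨hsub, hcard, -⟩ := mem_supports.1 hS
    have hne : S.Nonempty := card_pos.1 (by omega)
    obtain ⟨v, hv⟩ := hne
    exact mem_biUnion.2 ⟨v, hsub hv, mem_filter.2 ⟨hS, hv⟩⟩
  calc #(supports x n) ≤ #((supBall (n - 1) x).biUnion fun v => (supports x n).filter fun S => v ∈ S) := card_le_card hcover
    _ ≤ ∑ v ∈ supBall (n - 1) x, #((supports x n).filter fun S => v ∈ S) := card_biUnion_le
    _ ≤ ∑ v ∈ supBall (n - 1) x, (3 ^ d) ^ (2 * (n - 1)) := sum_le_sum fun v _ =>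
        ContourSetup.card_filter_starConn_le v n _ fun S hS => by
          obtain ⟨hS, hv⟩ := mem_filter.1 hS
          obtain ⟨-, hcard, hconn⟩ := mem_supports.1 hS
          exact ⟨hv, hcard, hconn⟩
    _ = (2 * (n - 1) + 1) ^ d * (3 ^ d) ^ (2 * (n - 1)) := by rw [sum_const, card_supBall, smul_eq_mul]

/-- The label/minus-site/origin data of a support. [cite: FriedliVelenik2017, §7.2.6] -/
def dataOf (S : Finset (Site d)) : Finset (Finset (Finset (Site d)) × Finset (Site d) × ℤˣ) :=
  (Comps S).powerset ×ˢ S.powerset ×ˢ univ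

/-- `#dataOf S ≤ 2^{3^d |S|} · 2^{|S|} · 2`. [cite: FriedliVelenik2017, Lemma 7.30 (entropy)] -/
theorem card_dataOf_le (S : Finset (Site d)) : #(dataOf S) ≤ 2 ^ (3 ^ d * #S) * 2 ^ #S * 2 := by
  rw [dataOf, card_product, card_product, card_powerset, card_powerset, card_univ, Fintype.card_units_int, ← mul_assoc]
  exact Nat.mul_le_mul_right _ (Nat.mul_le_mul_right _ (Nat.pow_le_pow_right (by norm_num) (card_Comps_le S)))

variable (b p R') in
/-- **The bad event** `{σ_x = -1}` as a set of finite configurations. [cite: FriedliVelenik2017, eq. (3.40)] -/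
def badEvt (x : Site d) : Finset (spacingVolume d b R' → ℤˣ) :=
  open Classical in univ.filter fun τ => glueW b p R' τ x = -1

/-- **Every bad configuration belongs to a sub-event** of an anchored support.
[cite: FriedliVelenik2017, §3.7.2 (a − spin is surrounded by a contour) and §7.3 (external contours)] -/
theorem badEvt_subset (hd : 2 ≤ d) (hb : 2 ≤ b) (hr : 2 ≤ r) {x : Site d} (hxs : IsSpin b x) :
    badEvt b p R' x ⊆ (Icc 1 #(box d (b * R' + r))).biUnion fun n => (supports x n).biUnion fun S =>
      (dataOf S).biUnion fun D => evt b r p R' S D.1 D.2.1 D.2.2 := by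
  classical
  intro τ hτ
  rw [badEvt, mem_filter] at hτ
  set σ := glueW b p R' τ with hσdef
  have hσ : IsCfg b p R' σ := isCfg_glue τ
  obtain ⟨S, hSne, hSconn, hcont, hplus, hxS⟩ := exists_plusExt_contour hd hb hr hσ hxs hτ.2
  have hSbox : S ⊆ box d (b * R' + r) := fun y hy => mem_box_of_isBad hσ (hcont.1 y hy)
  have hn1 : 1 ≤ #S := card_pos.2 hSne
  have hn2 : #S ≤ #(box d (b * R' + r)) := card_le_card hSbox
  refine mem_biUnion.2 ⟨#S, mem_Icc.2 ⟨hn1, hn2⟩, mem_biUnion.2 ⟨S, mem_supports.2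
    ⟨subset_supBall_of_not_mem_starExt hd hSconn hxS, rfl, hSconn⟩, mem_biUnion.2 ?_⟩⟩
  refine ⟨((Comps S).filter (IsMinusComp b r σ), (S.filter (IsSpin b)).filter (fun y => σ y = -1), σ 0), ?_, ?_⟩
  · rw [dataOf, mem_product, mem_product, mem_powerset, mem_powerset]
    exact ⟨filter_subset _ _, (filter_subset _ _).trans (filter_subset _ _), mem_univ _⟩
  · rw [mem_evt]
    refine ⟨hcont, hplus, fun A hA => ?_, fun y hy hys => ?_, rfl⟩
    · rw [mem_filter]; exact ⟨fun h => h.2, fun h => ⟨hA, h⟩⟩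
    · simp only [mem_filter]; tauto

/-- **The union bound**: `cfgProb (σ_x = -1) ≤ ∑_{n ≥ 1} (2n-1)^d 9^{d(n-1)} 2^{(3^d+1)n+1} e^{-β n/(6(2r+1)^d)}`,
as a finite sum. [cite: FriedliVelenik2017, §3.7.2, eqs. (3.38)–(3.39)] -/
theorem cfgProb_badEvt_le_sum (hd : 2 ≤ d) (hb : 3 ≤ b) (hr : b + 1 ≤ r) (hrd : 72 * d ≤ r) {β : ℝ} (hβ : 0 ≤ β)
    {x : Site d} (hxs : IsSpin b x) :
    cfgProb (zdGraph d) (spacingVolume d b R') β 0 (.fixed (ξb d b p R')) (badEvt b p R' x) ≤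
      ∑ n ∈ Icc 1 #(box d (b * R' + r)),
        ((2 * (n - 1) + 1) ^ d * (3 ^ d) ^ (2 * (n - 1)) : ℕ) * ((2 ^ (3 ^ d * n) * 2 ^ n * 2 : ℕ) : ℝ) *
          Real.exp (-(β * (n / (6 * (2 * r + 1) ^ d)))) := by
  classical
  have hr2 : 2 ≤ r := by omega
  have hb2 : 2 ≤ b := by omega
  refine (cfgProb_le_sum_of_subset_biUnion (zdGraph d) _ β 0 _ _ _ (badEvt_subset hd hb2 hr2 hxs)).trans (sum_le_sum fun n hn => ?_)
  have hn1 : 1 ≤ n := (mem_Icc.1 hn).1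
  refine (cfgProb_biUnion_le (zdGraph d) _ β 0 _ _ _).trans ?_
  have hS : ∀ S ∈ supports x n, cfgProb (zdGraph d) (spacingVolume d b R') β 0 (.fixed (ξb d b p R'))
      ((dataOf S).biUnion fun D => evt b r p R' S D.1 D.2.1 D.2.2) ≤
      ((2 ^ (3 ^ d * n) * 2 ^ n * 2 : ℕ) : ℝ) * Real.exp (-(β * (n / (6 * (2 * r + 1) ^ d)))) := by
    intro S hS
    obtain ⟨-, hcard, hconn⟩ := mem_supports.1 hS
    have hSne : S.Nonempty := card_pos.1 (by omega)
    refine (cfgProb_biUnion_le (zdGraph d) _ β 0 _ _ _).trans ?_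
    calc ∑ D ∈ dataOf S, cfgProb (zdGraph d) (spacingVolume d b R') β 0 (.fixed (ξb d b p R')) (evt b r p R' S D.1 D.2.1 D.2.2)
        ≤ ∑ D ∈ dataOf S, Real.exp (-(β * (n / (6 * (2 * r + 1) ^ d)))) := sum_le_sum fun D hD => by
          obtain ⟨hL, -⟩ := mem_product.1 hD
          rw [← hcard]
          exact cfgProb_evt_le hd hb hr hrd hβ hSne hconn (mem_powerset.1 hL) _ _
      _ = #(dataOf S) * Real.exp (-(β * (n / (6 * (2 * r + 1) ^ d)))) := by rw [sum_const, nsmul_eq_mul]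
      _ ≤ ((2 ^ (3 ^ d * n) * 2 ^ n * 2 : ℕ) : ℝ) * Real.exp (-(β * (n / (6 * (2 * r + 1) ^ d)))) := by
          gcongr
          have := card_dataOf_le S
          rw [hcard] at this
          exact_mod_cast this
  calc ∑ S ∈ supports x n, cfgProb (zdGraph d) (spacingVolume d b R') β 0 (.fixed (ξb d b p R'))
        ((dataOf S).biUnion fun D => evt b r p R' S D.1 D.2.1 D.2.2)
      ≤ ∑ S ∈ supports x n, ((2 ^ (3 ^ d * n) * 2 ^ n * 2 : ℕ) : ℝ) * Real.exp (-(β * (n / (6 * (2 * r + 1) ^ d)))) :=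
        sum_le_sum hS
    _ = #(supports x n) * (((2 ^ (3 ^ d * n) * 2 ^ n * 2 : ℕ) : ℝ) * Real.exp (-(β * (n / (6 * (2 * r + 1) ^ d))))) := by
        rw [sum_const, nsmul_eq_mul]
    _ ≤ ((2 * (n - 1) + 1) ^ d * (3 ^ d) ^ (2 * (n - 1)) : ℕ) * (((2 ^ (3 ^ d * n) * 2 ^ n * 2 : ℕ) : ℝ) *
          Real.exp (-(β * (n / (6 * (2 * r + 1) ^ d))))) := by
        gcongr
        exact_mod_cast card_supports_le x hn1
    _ = _ := by ring

end Union

/-! ### The geometric series -/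

section Series

variable {b r : ℕ} {p : ℤˣ} {R' : ℕ}

/-- `2(n-1)+1 ≤ 2^n` for `n ≥ 1`. [folklore] -/
theorem two_mul_pred_add_one_le_two_pow {n : ℕ} (hn : 1 ≤ n) : 2 * (n - 1) + 1 ≤ 2 ^ n := by
  have h := Nat.lt_two_pow_self (n := n - 1)
  have : 2 ^ n = 2 * 2 ^ (n - 1) := by rw [← pow_succ']; congr 1; omega
  omega

/-- **The entropy constant** `C_d = 2^d · 9^d · 2^{3^d + 1}` of the Peierls sum. [cite: FriedliVelenik2017, §3.7.2, eq. (3.39)] -/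
def entC (d : ℕ) : ℝ := 2 ^ d * 9 ^ d * 2 ^ (3 ^ d + 1)

/-- `C_d ≥ 1`. [folklore] -/
theorem one_le_entC (d : ℕ) : 1 ≤ entC d := by
  unfold entC
  have h1 : (1 : ℝ) ≤ 2 ^ d := one_le_pow₀ (by norm_num)
  have h2 : (1 : ℝ) ≤ 9 ^ d := one_le_pow₀ (by norm_num)
  have h3 : (1 : ℝ) ≤ 2 ^ (3 ^ d + 1) := one_le_pow₀ (by norm_num)
  calc (1 : ℝ) = 1 * 1 * 1 := by ring
    _ ≤ 2 ^ d * 9 ^ d * 2 ^ (3 ^ d + 1) := by gcongr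

/-- **Each term of the Peierls sum is at most `2 (C_d e^{-β/(6(2r+1)^d)})^n`.**
[cite: FriedliVelenik2017, §3.7.2, eq. (3.39)] -/
theorem term_le (β : ℝ) {n : ℕ} (hn : 1 ≤ n) :
    ((2 * (n - 1) + 1) ^ d * (3 ^ d) ^ (2 * (n - 1)) : ℕ) * ((2 ^ (3 ^ d * n) * 2 ^ n * 2 : ℕ) : ℝ) *
        Real.exp (-(β * (n / (6 * (2 * r + 1) ^ d)))) ≤
      2 * (entC d * Real.exp (-(β / (6 * (2 * r + 1) ^ d)))) ^ n := by
  have hA : (((2 * (n - 1) + 1) ^ d * (3 ^ d) ^ (2 * (n - 1)) : ℕ) : ℝ) ≤ (2 ^ d) ^ n * (9 ^ d) ^ n := by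
    have h1 : (2 * (n - 1) + 1) ^ d ≤ (2 ^ d) ^ n := by
      calc (2 * (n - 1) + 1) ^ d ≤ (2 ^ n) ^ d := Nat.pow_le_pow_left (two_mul_pred_add_one_le_two_pow hn) d
        _ = (2 ^ d) ^ n := by rw [← pow_mul, ← pow_mul, mul_comm]
    have h2 : (3 ^ d) ^ (2 * (n - 1)) ≤ (9 ^ d) ^ n := by
      calc (3 ^ d) ^ (2 * (n - 1)) = (9 ^ d) ^ (n - 1) := by
            rw [← pow_mul, ← pow_mul, show (9 : ℕ) = 3 ^ 2 by norm_num, ← pow_mul]; congr 1; ring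
        _ ≤ (9 ^ d) ^ n := Nat.pow_le_pow_right (Nat.one_le_pow _ _ (by norm_num)) (by omega)
    have := Nat.mul_le_mul h1 h2
    exact_mod_cast this
  have hB : (((2 ^ (3 ^ d * n) * 2 ^ n * 2 : ℕ)) : ℝ) = 2 * (2 ^ (3 ^ d + 1)) ^ n := by
    push_cast
    rw [← pow_mul, add_mul, one_mul, pow_add]
    ring
  have hE : Real.exp (-(β * (n / (6 * (2 * r + 1) ^ d)))) = Real.exp (-(β / (6 * (2 * r + 1) ^ d))) ^ n := by
    rw [← Real.exp_nat_mul]; congr 1; ring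
  rw [hB, hE]
  have hpos : (0 : ℝ) ≤ Real.exp (-(β / (6 * (2 * r + 1) ^ d))) ^ n := pow_nonneg (Real.exp_pos _).le n
  calc (((2 * (n - 1) + 1) ^ d * (3 ^ d) ^ (2 * (n - 1)) : ℕ) : ℝ) * (2 * (2 ^ (3 ^ d + 1)) ^ n) * Real.exp (-(β / (6 * (2 * r + 1) ^ d))) ^ n
      ≤ ((2 ^ d) ^ n * (9 ^ d) ^ n) * (2 * (2 ^ (3 ^ d + 1)) ^ n) * Real.exp (-(β / (6 * (2 * r + 1) ^ d))) ^ n := by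
        gcongr
    _ = 2 * (entC d * Real.exp (-(β / (6 * (2 * r + 1) ^ d)))) ^ n := by
        unfold entC; rw [mul_pow, mul_pow, mul_pow]; ring

/-- **The Peierls sum is at most `4ρ`** for `ρ = C_d e^{-β/(6(2r+1)^d)} ≤ 1/2`. [cite: FriedliVelenik2017, §3.7.2, eq. (3.39)] -/
theorem sum_le_four_mul (β : ℝ) (N : ℕ) {ρ : ℝ} (hρdef : ρ = entC d * Real.exp (-(β / (6 * (2 * r + 1) ^ d)))) (hρ : ρ ≤ 1 / 2) :
    ∑ n ∈ Icc 1 N, ((2 * (n - 1) + 1) ^ d * (3 ^ d) ^ (2 * (n - 1)) : ℕ) * ((2 ^ (3 ^ d * n) * 2 ^ n * 2 : ℕ) : ℝ) *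
        Real.exp (-(β * (n / (6 * (2 * r + 1) ^ d)))) ≤ 4 * ρ := by
  have hρ0 : 0 ≤ ρ := by rw [hρdef]; exact mul_nonneg (le_trans zero_le_one (one_le_entC d)) (Real.exp_pos _).le
  calc ∑ n ∈ Icc 1 N, ((2 * (n - 1) + 1) ^ d * (3 ^ d) ^ (2 * (n - 1)) : ℕ) * ((2 ^ (3 ^ d * n) * 2 ^ n * 2 : ℕ) : ℝ) *
          Real.exp (-(β * (n / (6 * (2 * r + 1) ^ d))))
      ≤ ∑ n ∈ Icc 1 N, 2 * ρ ^ n := sum_le_sum fun n hn => by rw [hρdef]; exact term_le β (mem_Icc.1 hn).1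
    _ = 2 * ∑ n ∈ Ico 1 (N + 1), ρ ^ n := by rw [mul_sum]; rfl
    _ ≤ 2 * (ρ ^ 1 / (1 - ρ)) := by
        gcongr
        exact geom_sum_Ico_le_of_lt_one hρ0 (by linarith)
    _ ≤ 4 * ρ := by
        rw [pow_one, div_eq_mul_inv]
        have : (1 - ρ)⁻¹ ≤ 2 := by rw [inv_le_comm₀ (by linarith) two_pos]; linarith
        nlinarith

variable (d b r) in
/-- **The temperature threshold** `J₂ = 6 (2r+1)^d log(64 d C_d) + 1` of the Peierls estimate.
[cite: FriedliVelenik2017, §3.7.2 ("for all β large enough")] -/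
def J₂ : ℝ := 6 * (2 * r + 1) ^ d * Real.log (64 * d * entC d) + 1

/-- `J₂ ≥ 1`. [folklore] -/
theorem one_le_J₂ (hd : 1 ≤ d) : 1 ≤ J₂ d r := by
  unfold J₂
  have hlog : 0 ≤ Real.log (64 * d * entC d) := Real.log_nonneg (by
    have h1 := one_le_entC d; have h2 : (1 : ℝ) ≤ d := by exact_mod_cast hd
    calc (1 : ℝ) = 1 * 1 * 1 := by ring
      _ ≤ 64 * d * entC d := by gcongr; norm_num)
  have : (0 : ℝ) ≤ 6 * (2 * r + 1) ^ d * Real.log (64 * d * entC d) := by positivity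
  linarith

/-- For `β ≥ J₂`, `ρ = C_d e^{-β/(6(2r+1)^d)} ≤ 1/(64 d)`. [cite: FriedliVelenik2017, §3.7.2] -/
theorem rho_le (hd : 1 ≤ d) {β : ℝ} (hβ : J₂ d r ≤ β) :
    entC d * Real.exp (-(β / (6 * (2 * r + 1) ^ d))) ≤ 1 / (64 * d) := by
  have hK : (0 : ℝ) < 6 * (2 * r + 1) ^ d := by positivity
  have hd' : (1 : ℝ) ≤ d := by exact_mod_cast hd
  have hdpos : (0 : ℝ) < 64 * d := by linarith
  have hC := one_le_entC d
  have hprod : 0 < 64 * d * entC d := by positivity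
  -- `β / (6K) ≥ log (64 d C)`
  have h1 : Real.log (64 * d * entC d) ≤ β / (6 * (2 * r + 1) ^ d) := by
    rw [le_div_iff₀ hK]
    unfold J₂ at hβ
    nlinarith
  calc entC d * Real.exp (-(β / (6 * (2 * r + 1) ^ d))) ≤ entC d * Real.exp (-Real.log (64 * d * entC d)) := by
        gcongr
    _ = entC d * (64 * d * entC d)⁻¹ := by rw [Real.exp_neg, Real.exp_log hprod]
    _ = 1 / (64 * d) := by field_simp

/-- **The Peierls estimate**: for `β ≥ J₂` and every spin site `x`, `cfgProb (σ_x = -1) ≤ 1/(16 d)`,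
uniformly in `R'` and the parity `p`. [cite: FriedliVelenik2017, §3.7.2, eqs. (3.38)–(3.40); VanenterFernandezSokal1993, §4.3.2] -/
theorem cfgProb_badEvt_le (hd : 2 ≤ d) (hb : 3 ≤ b) (hr : b + 1 ≤ r) (hrd : 72 * d ≤ r) {β : ℝ} (hβ : J₂ d r ≤ β)
    {x : Site d} (hxs : IsSpin b x) :
    cfgProb (zdGraph d) (spacingVolume d b R') β 0 (.fixed (ξb d b p R')) (badEvt b p R' x) ≤ 1 / (16 * d) := by
  have hd1 : 1 ≤ d := by omega
  have hβ0 : 0 ≤ β := le_trans (le_trans zero_le_one (one_le_J₂ (r := r) hd1)) hβ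
  have hρ := rho_le (r := r) hd1 hβ
  have hdpos : (1 : ℝ) ≤ d := by exact_mod_cast hd1
  have hρ2 : entC d * Real.exp (-(β / (6 * (2 * r + 1) ^ d))) ≤ 1 / 2 :=
    hρ.trans (by rw [div_le_div_iff₀ (by positivity) two_pos]; linarith)
  refine (cfgProb_badEvt_le_sum hd hb hr hrd hβ0 hxs).trans ((sum_le_four_mul β _ rfl hρ2).trans ?_)
  calc 4 * (entC d * Real.exp (-(β / (6 * (2 * r + 1) ^ d)))) ≤ 4 * (1 / (64 * d)) := by gcongr
    _ = 1 / (16 * d) := by field_simp; ring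

end Series

/-! ### Unfixing the origin: the plus-phase bound, and `VEFS1993_eq413_spacing` -/

section Main

variable {b : ℕ} {p : ℤˣ} {R' : ℕ}

/-- **The origin is rarely `-` when its petals are `+`**: `μ(σ_0 = -1, σ ≡ +1 on the petals) ≤ e^{-4dβ}`
(Peierls' flip estimate at the single site `0`, with `2d` good bonds and no bad bond).
[cite: VanenterFernandezSokal1993, §4.1.2 Step 3 (unfixing the origin); FriedliVelenik2017, Lemma 3.36] -/
theorem cfgProb_origin_le {β : ℝ} (hβ : 0 ≤ β) :
    cfgProb (zdGraph d) (spacingVolume d b R') β 0 (.fixed (ξb d b p R'))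
        (open Classical in univ.filter fun τ => glueW b p R' τ 0 = -1 ∧ ∀ z ∈ (zdGraph d).neighborFinset 0, glueW b p R' τ z = 1) ≤
      Real.exp (-(4 * d * β)) := by
  classical
  have hmeas := measurableSet_minusOn_plusOn (V := Site d) {0} ((zdGraph d).neighborFinset 0)
  have hle := isingMeasure_real_minusOn_plusOn_le (zdGraph d) (spacingVolume d b R') hβ le_rfl (ξb d b p R')
    (T := {0}) (singleton_subset_iff.2 (zero_mem_spacingVolume b R')) ((zdGraph d).neighborFinset 0)
  rw [isingMeasure_real_eq_cfgProb (zdGraph d) _ β 0 _ hmeas] at hle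
  -- the counts: `2d` good bonds, `0` bad bonds
  have hout : outNbrs (zdGraph d) ({0} : Finset (Site d)) 0 = (zdGraph d).neighborFinset 0 := by
    ext z
    rw [mem_outNbrs, SimpleGraph.mem_neighborFinset, mem_singleton]
    exact ⟨fun h => h.1, fun h => ⟨h, fun hz => (h.ne hz.symm).elim⟩⟩
  have hgood : goodPairCount (zdGraph d) ({0} : Finset (Site d)) ((zdGraph d).neighborFinset 0) = 2 * d := by
    rw [goodPairCount, sum_singleton, hout, filter_true_of_mem fun z hz => hz]
    exact (card_neighborFinset_zdGraph_holds (d := d)) 0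
  have hbad : badPairCount (zdGraph d) ({0} : Finset (Site d)) ((zdGraph d).neighborFinset 0) = 0 := by
    rw [badPairCount, sum_singleton, hout, card_eq_zero, filter_false_of_mem fun z hz => not_not.2 hz]
  rw [hgood, hbad] at hle
  push_cast at hle
  rw [sub_zero, show 2 * β * (2 * (d : ℝ)) = 4 * d * β by ring] at hle
  refine le_trans (le_of_eq ?_) hle
  congr 1
  ext τ
  simp only [mem_filter, mem_univ, true_and, Set.mem_setOf_eq, mem_singleton, forall_eq]

/-- **Reduction to the petals**: `μ(σ_0 = -1) ≤ e^{-4dβ} + ∑_{f ∼ 0} μ(σ_f = -1)`.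
[cite: VanenterFernandezSokal1993, §4.1.2 Step 3, eqs. (4.10)–(4.13)] -/
theorem cfgProb_badEvt_zero_le {β : ℝ} (hβ : 0 ≤ β) :
    cfgProb (zdGraph d) (spacingVolume d b R') β 0 (.fixed (ξb d b p R')) (badEvt b p R' 0) ≤
      Real.exp (-(4 * d * β)) + ∑ f ∈ (zdGraph d).neighborFinset 0,
        cfgProb (zdGraph d) (spacingVolume d b R') β 0 (.fixed (ξb d b p R')) (badEvt b p R' f) := by
  classical
  set E₀ : Finset (spacingVolume d b R' → ℤˣ) :=
    univ.filter fun τ => glueW b p R' τ 0 = -1 ∧ ∀ z ∈ (zdGraph d).neighborFinset 0, glueW b p R' τ z = 1 with hE₀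
  have hsub : badEvt b p R' 0 ⊆ E₀ ∪ ((zdGraph d).neighborFinset 0).biUnion fun f => badEvt b p R' f := by
    intro τ hτ
    rw [badEvt, mem_filter] at hτ
    by_cases hall : ∀ z ∈ (zdGraph d).neighborFinset 0, glueW b p R' τ z = 1
    · exact mem_union_left _ (mem_filter.2 ⟨mem_univ _, hτ.2, hall⟩)
    · push Not at hall
      obtain ⟨f, hf, hne⟩ := hall
      refine mem_union_right _ (mem_biUnion.2 ⟨f, hf, ?_⟩)
      rw [badEvt, mem_filter]
      exact ⟨mem_univ _, (Int.units_eq_one_or _).resolve_left hne⟩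
  refine (cfgProb_mono (zdGraph d) _ β 0 _ hsub).trans ((cfgProb_union_le (zdGraph d) _ β 0 _ _ _).trans (add_le_add ?_ ?_))
  · exact cfgProb_origin_le hβ
  · exact cfgProb_biUnion_le (zdGraph d) _ β 0 _ _ _

/-- `e^{-8} ≤ 1/8`. [folklore] -/
theorem exp_neg_eight_le : Real.exp (-8) ≤ 1 / 8 := by
  rw [Real.exp_neg, inv_le_comm₀ (Real.exp_pos 8) (by norm_num), one_div, inv_inv]
  have := Real.add_one_le_exp (8 : ℝ)
  linarith

/-- **The plus-phase bound for spacings `b ≥ 3`** — the hypothesis of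
`VEFS1993_eq413_spacing_of_plusPhase_three_le`, i.e. the finite-volume form of `VEFS1993_plusPhase` at
every `(d, b)` with `d ≥ 2`, `b ≥ 3`: for `β > J₂` the magnetisation at the (unfixed) origin of the system
with fully alternating image spins of either parity on `Λ_{R'}` and `+` exterior is at least `1/2`,
uniformly in `R'`. The source obtains this from Pirogov–Sinai theory (§4.3.2: "It follows from P–S theory
that at low temperature there are precisely two periodic Gibbs measures, `μ₊` and `μ₋`, characterized
respectively by a strictly positive or strictly negative magnetization"; App. B.5.3); here it is proved
by the twisted Peierls argument of `…Contours{,Energy}.lean`, using that the two ground states are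
exchanged by the symmetry (spin flip) ∘ (translation by `b e₀`).
[cite: VanenterFernandezSokal1993, §4.3.1 Steps 2.3–2.4, §4.3.2 and App. B.5.3] -/
theorem plusPhase_three_le (d b : ℕ) (hd : 2 ≤ d) (hb : 3 ≤ b) :
    ∃ J₂ : ℝ, ∀ β : ℝ, J₂ < β → ∃ c : ℝ, 0 < c ∧ ∀ p : ℤˣ, ∀ R' : ℕ,
      c ≤ isingExpect (zdGraph d) (spacingVolume d b R') β 0
        (.fixed (signedCoreAnnulusBC d b p R' R' 1 1)) (spinAt 0) := by
  classical
  set r := b + 72 * d with hr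
  refine ⟨J₂ d r, fun β hβ => ⟨1 / 2, by norm_num, fun p R' => ?_⟩⟩
  have hd1 : 1 ≤ d := by omega
  have hb2 : 2 ≤ b := by omega
  have hβ1 : 1 ≤ β := le_trans (one_le_J₂ (r := r) hd1) hβ.le
  have hβ0 : 0 ≤ β := le_trans zero_le_one hβ1
  -- `⟨σ_0⟩ = 1 - 2 μ(σ_0 = -1)`
  have hbad : cfgProb (zdGraph d) (spacingVolume d b R') β 0 (.fixed (ξb d b p R')) (badEvt b p R' 0) ≤ 1 / 4 := by
    refine (cfgProb_badEvt_zero_le hβ0).trans ?_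
    have hpet : ∀ f ∈ (zdGraph d).neighborFinset 0,
        cfgProb (zdGraph d) (spacingVolume d b R') β 0 (.fixed (ξb d b p R')) (badEvt b p R' f) ≤ 1 / (16 * d) := fun f hf =>
      cfgProb_badEvt_le hd hb (by omega) (by omega) hβ.le
        (isSpin_of_not_isSpImageSite (not_isSpImageSite_of_adj_zero hb2 ((SimpleGraph.mem_neighborFinset _ _ _).1 hf)))
    have hsum : ∑ f ∈ (zdGraph d).neighborFinset 0,
        cfgProb (zdGraph d) (spacingVolume d b R') β 0 (.fixed (ξb d b p R')) (badEvt b p R' f) ≤ 1 / 8 := by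
      refine (sum_le_sum hpet).trans ?_
      rw [sum_const, (card_neighborFinset_zdGraph_holds (d := d)) 0, nsmul_eq_mul]
      have hdpos : (0 : ℝ) < d := by exact_mod_cast (by omega : 0 < d)
      rw [show ((2 * d : ℕ) : ℝ) * (1 / (16 * d)) = 1 / 8 by field_simp; push_cast; ring]
    have hexp : Real.exp (-(4 * d * β)) ≤ 1 / 8 := by
      refine le_trans (Real.exp_le_exp.2 ?_) exp_neg_eight_le
      have : (2 : ℝ) ≤ d := by exact_mod_cast hd
      nlinarith
    linarith
  have key := one_sub_two_mul_le_isingExpect_spinAt (zdGraph d) (spacingVolume d b R') β 0 (.fixed (ξb d b p R')) 0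
    (ε := 1 / 4) (by
      refine le_trans (le_of_eq ?_) hbad
      congr 1)
  rw [ξb] at key
  linarith

end Main

end SpacingPeierls

/-- **`VEFS1993_eq413_spacing` holds**: the uniform finite-volume Griffiths–Pearce–Israel estimate (4.13)
behind Theorem 4.3 (decimation with spacing `b ≥ 2`, `d ≥ 2`), from the plus-phase bound for `b ≥ 3`
(`SpacingPeierls.plusPhase_three_le`) and the tree's reduction `VEFS1993_eq413_spacing_of_plusPhase_three_le`
(which contains the `b = 2` case, Theorems 4.1/4.2).
[cite: VanenterFernandezSokal1993, Theorem 4.3, §4.3.1 Step 2 eqs. (4.26)–(4.27), §4.3.2, App. B.5.3] -/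
theorem VEFS1993_eq413_spacing_holds : VEFS1993_eq413_spacing :=
  VEFS1993_eq413_spacing_of_plusPhase_three_le SpacingPeierls.plusPhase_three_le

end Literature.Barriers.CriticalPhenomena.NonGibbs

end
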